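import Summits.RiemannHypothesis.RiemannHypothesis.Theorems.PfPersistenceGalerkinFormDecay
import Literature.NumberTheory.LFunctions.WeilExplicitContinuous
import Literature.NumberTheory.LFunctions.WeilArchimedeanPositivityProofs
import HarnessLib

/-!
# PF persistence — GAL-0 piece (ii), STEP 2: the autocorrelation of a cut-off continuous
# function is continuous with compact support; the mollification engine applies to the
# cut-off Galerkin profile (pub-rhpf barrier-prover g2)

HONEST FRAMING: long-odds mechanism search; no RH claims.  Continues
`Theorems/PfPersistenceGalerkinFormMellin.lean` (STEP 3a) and `…GalerkinFormDecay.lean` (STEP 3b).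

For `F = 1_{[-b,b]} · f` with `f : ℝ → ℂ` continuous (the cut-off Galerkin profile
`cutoffProfile win v` is the case `b = a`, `f = θ_v`; its inward dilates — STEP 1 — are the
cases `b = λa`, `f = θ_v(·/λ)`), the autocorrelation `A = F ⋆ F̃`, `F̃(u) = conj F(-u)`, is
NOT covered by the tree's test-function API (`F` jumps at `±b`).  PROVED here (RH-free):

* `weilConv_weilReflect_cutoff_eq` — the window formula
  `A(x) = ∫_{l(x)}^{m(x)} f(u) conj f(u - x) du`, `l(x) = max(-b, x-b)`,
  `m(x) = max(l(x), min(b, x+b))` (an interval integral with continuous end-points);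
* `continuous_weilConv_weilReflect_cutoff` — `A` is continuous;
* `weilConv_weilReflect_cutoff_eq_zero` / `hasCompactSupport_weilConv_weilReflect_cutoff` —
  `A(x) = 0` for `|x| > 2b`, so `A` has compact support;
* `cutoffProfile_eq_indicator` and the instances for the Galerkin profile, and the ENGINE
  COROLLARY `tendsto_weilFunctional_autocorr_cutoffProfile_moll`: with `A = G ⋆ G̃`,
  `G = cutoffProfile win v`,  `W(A ⋆ φ_k) → W(A) = weilQuadratic G` along the tree's mollifiers
  `φ_k = WeilContinuous.moll k` (`WeilContinuous.tendsto_weilFunctional_moll` fed with the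
  continuity and compact support proved here and the integrability `hA` of STEP 3b).

What remains for `CutoffProfileFormDensity` (GAL-0 piece (ii)) after this file: the same engine
limit along the SQUARED mollifiers `φ_k ⋆ φ_k` (the autocorrelation of `G_λ ⋆ φ_k` is
`A_λ ⋆ (φ_k ⋆ φ_k)`), the inward dilation `G_λ` (support strictly inside `[-a, a]`) and the
`L²`/form continuity in `λ` — see `HOME/pub-rhpf-barrier-prover/PROOF-PLAN.md`.
-/

set_option linter.dupNamespace false

noncomputable section

open Complex Filter Set MeasureTheory intervalIntegral
open scoped Real Topology ComplexConjugate

namespace Summit.RiemannHypothesis.RiemannHypothesis.Theorems.PfPersistence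

open Literature.NumberTheory.LFunctions

/-! ## §1 The autocorrelation of a cut-off continuous function -/

section Cutoff

variable {f : ℝ → ℂ} {b : ℝ}

/-- Left end-point `l(x) = max(-b, x - b)` of the overlap window `[-b,b] ∩ (x + [-b,b])`. [folklore] -/
def overlapLeft (b x : ℝ) : ℝ := max (-b) (x - b)

/-- Clamped right end-point `m(x) = max(l(x), min(b, x + b))` of the overlap window. [folklore] -/
def overlapRight (b x : ℝ) : ℝ := max (overlapLeft b x) (min b (x + b))

/-- `l ≤ m`. [folklore] -/
theorem overlapLeft_le_overlapRight (b x : ℝ) : overlapLeft b x ≤ overlapRight b x :=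
  le_max_left _ _

/-- The end-points are continuous in `x`. [folklore] -/
theorem continuous_overlapLeft (b : ℝ) : Continuous (overlapLeft b) := by
  unfold overlapLeft; fun_prop

/-- The end-points are continuous in `x`. [folklore] -/
theorem continuous_overlapRight (b : ℝ) : Continuous (overlapRight b) := by
  unfold overlapRight overlapLeft; fun_prop

/-- Membership in the overlap window: `u ∈ [l, min(b, x+b)] ↔ u ∈ [-b,b] ∧ u - x ∈ [-b,b]`. [folklore] -/
theorem mem_overlap_iff (b x u : ℝ) :
    u ∈ Icc (overlapLeft b x) (min b (x + b)) ↔ u ∈ Icc (-b) b ∧ u - x ∈ Icc (-b) b := by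
  simp only [overlapLeft, mem_Icc, max_le_iff, le_min_iff]
  constructor
  · rintro ⟨⟨h1, h2⟩, h3, h4⟩; exact ⟨⟨h1, h3⟩, by linarith, by linarith⟩
  · rintro ⟨⟨h1, h3⟩, h2, h4⟩; exact ⟨⟨h1, by linarith⟩, h3, by linarith⟩

/-- Pointwise: the integrand of `F ⋆ F̃` at `x` is the overlap-window indicator of
`u ↦ f(u) conj f(u - x)`. [folklore] -/
theorem cutoff_mul_conj_cutoff (f : ℝ → ℂ) (b x u : ℝ) :
    (Icc (-b) b).indicator f u * conj ((Icc (-b) b).indicator f (u - x)) =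
      (Icc (overlapLeft b x) (min b (x + b))).indicator (fun u ↦ f u * conj (f (u - x))) u := by
  by_cases hu : u ∈ Icc (-b) b
  · by_cases hux : u - x ∈ Icc (-b) b
    · have hm : u ∈ Icc (overlapLeft b x) (min b (x + b)) := (mem_overlap_iff b x u).2 ⟨hu, hux⟩
      rw [indicator_of_mem hu, indicator_of_mem hux, indicator_of_mem hm]
    · have hm : u ∉ Icc (overlapLeft b x) (min b (x + b)) :=
        fun h ↦ hux ((mem_overlap_iff b x u).1 h).2
      rw [indicator_of_notMem hux, indicator_of_notMem hm, map_zero, mul_zero]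
  · have hm : u ∉ Icc (overlapLeft b x) (min b (x + b)) :=
      fun h ↦ hu ((mem_overlap_iff b x u).1 h).1
    rw [indicator_of_notMem hu, indicator_of_notMem hm, zero_mul]

/-- A set integral over `[l, r]` is the interval integral over `l..max(l, r)` (both vanish when
`r < l`). [folklore] -/
theorem setIntegral_Icc_eq_intervalIntegral_max (h : ℝ → ℂ) (l r : ℝ) :
    ∫ u in Icc l r, h u = ∫ u in l..max l r, h u := by
  rcases le_or_gt l r with hlr | hrl
  · rw [max_eq_right hlr, intervalIntegral.integral_of_le hlr, integral_Icc_eq_integral_Ioc]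
  · rw [max_eq_left hrl.le, intervalIntegral.integral_same, Icc_eq_empty (not_le.2 hrl),
      Measure.restrict_empty, integral_zero_measure]

/-- **Window formula**: `(F ⋆ F̃)(x) = ∫_{l(x)}^{m(x)} f(u) conj f(u-x) du` for the cut-off
`F = 1_{[-b,b]} f` of any `f`. [folklore] -/
theorem weilConv_weilReflect_cutoff_eq (f : ℝ → ℂ) (b x : ℝ) :
    weilConv ((Icc (-b) b).indicator f) (weilReflect ((Icc (-b) b).indicator f)) x =
      ∫ u in (overlapLeft b x)..(overlapRight b x), f u * conj (f (u - x)) := by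
  rw [weilConv_apply]
  have hpt : (fun u ↦ (Icc (-b) b).indicator f u *
      weilReflect ((Icc (-b) b).indicator f) (x - u)) =
      (Icc (overlapLeft b x) (min b (x + b))).indicator (fun u ↦ f u * conj (f (u - x))) := by
    funext u
    rw [weilReflect, neg_sub]
    exact cutoff_mul_conj_cutoff f b x u
  rw [hpt, MeasureTheory.integral_indicator measurableSet_Icc,
    setIntegral_Icc_eq_intervalIntegral_max]
  rfl

/-- **Continuity** of the autocorrelation of a cut-off continuous function. [folklore] -/
theorem continuous_weilConv_weilReflect_cutoff (hf : Continuous f) (b : ℝ) :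
    Continuous (weilConv ((Icc (-b) b).indicator f) (weilReflect ((Icc (-b) b).indicator f))) := by
  have heq : weilConv ((Icc (-b) b).indicator f) (weilReflect ((Icc (-b) b).indicator f)) =
      fun x ↦ ∫ u in (overlapLeft b x)..(overlapRight b x), f u * conj (f (u - x)) :=
    funext (weilConv_weilReflect_cutoff_eq f b)
  rw [heq]
  set k : ℝ → ℝ → ℂ := fun x u ↦ f u * conj (f (u - x)) with hk
  have hkc : Continuous (Function.uncurry k) := by
    have h1 : Continuous fun p : ℝ × ℝ ↦ f p.2 := hf.comp continuous_snd
    have h2 : Continuous fun p : ℝ × ℝ ↦ conj (f (p.2 - p.1)) :=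
      Complex.continuous_conj.comp (hf.comp (continuous_snd.sub continuous_fst))
    exact h1.mul h2
  have hku : ∀ x, Continuous (k x) := fun x ↦ (hf.mul (Complex.continuous_conj.comp
    (hf.comp (continuous_id.sub continuous_const))))
  have hsplit : (fun x ↦ ∫ u in (overlapLeft b x)..(overlapRight b x), k x u) =
      fun x ↦ (∫ u in (0 : ℝ)..(overlapRight b x), k x u) - ∫ u in (0 : ℝ)..(overlapLeft b x), k x u := by
    funext x
    rw [intervalIntegral.integral_interval_sub_left ((hku x).intervalIntegrable _ _)
      ((hku x).intervalIntegrable _ _)]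
  change Continuous fun x ↦ ∫ u in (overlapLeft b x)..(overlapRight b x), k x u
  rw [hsplit]
  exact (intervalIntegral.continuous_parametric_intervalIntegral_of_continuous hkc
    (continuous_overlapRight b)).sub
    (intervalIntegral.continuous_parametric_intervalIntegral_of_continuous hkc
      (continuous_overlapLeft b))

/-- Outside `[-2b, 2b]` the overlap window is empty: `m(x) = l(x)`. [folklore] -/
theorem overlapRight_eq_overlapLeft {b x : ℝ} (hx : 2 * b < |x|) : overlapRight b x = overlapLeft b x := by
  unfold overlapRight overlapLeft
  refine max_eq_left ?_
  rcases le_or_gt 0 x with h0 | h0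
  · rw [abs_of_nonneg h0] at hx
    calc min b (x + b) ≤ b := min_le_left _ _
      _ ≤ x - b := by linarith
      _ ≤ max (-b) (x - b) := le_max_right _ _
  · rw [abs_of_neg h0] at hx
    calc min b (x + b) ≤ x + b := min_le_right _ _
      _ ≤ -b := by linarith
      _ ≤ max (-b) (x - b) := le_max_left _ _

/-- The autocorrelation of a cut-off function VANISHES for `|x| > 2b`. [folklore] -/
theorem weilConv_weilReflect_cutoff_eq_zero (f : ℝ → ℂ) {b x : ℝ} (hx : 2 * b < |x|) :
    weilConv ((Icc (-b) b).indicator f) (weilReflect ((Icc (-b) b).indicator f)) x = 0 := by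
  rw [weilConv_weilReflect_cutoff_eq, overlapRight_eq_overlapLeft hx, intervalIntegral.integral_same]

/-- The autocorrelation of a cut-off function has COMPACT SUPPORT (inside `[-2b, 2b]`). [folklore] -/
theorem hasCompactSupport_weilConv_weilReflect_cutoff (f : ℝ → ℂ) (b : ℝ) :
    HasCompactSupport
      (weilConv ((Icc (-b) b).indicator f) (weilReflect ((Icc (-b) b).indicator f))) := by
  refine HasCompactSupport.intro (isCompact_Icc (a := -(2 * b)) (b := 2 * b)) fun x hx ↦ ?_
  refine weilConv_weilReflect_cutoff_eq_zero f ?_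
  simp only [mem_Icc, not_and_or, not_le] at hx
  rcases hx with h | h
  · have : -x ≤ |x| := neg_le_abs x
    linarith
  · exact lt_of_lt_of_le h (le_abs_self x)

end Cutoff

/-! ## §2 The cut-off Galerkin profile -/

/-- The cut-off Galerkin profile is the cut-off `1_{[-a,a]} θ_v` of the complex profile. [folklore] -/
theorem cutoffProfile_eq_indicator (win : Window) (v : Fin (win.N + 1) → ℝ) :
    cutoffProfile win v = (Icc (-win.a) win.a).indicator (profileC (2 * win.a) v) := by
  funext t
  by_cases ht : t ∈ Icc (-win.a) win.a
  · simp [cutoffProfile, profileC, indicator_of_mem ht]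
  · simp [cutoffProfile, indicator_of_notMem ht]

/-- The autocorrelation `A = G ⋆ G̃` of the cut-off Galerkin profile is continuous. [folklore] -/
theorem continuous_autocorr_cutoffProfile (win : Window) (v : Fin (win.N + 1) → ℝ) :
    Continuous (weilConv (cutoffProfile win v) (weilReflect (cutoffProfile win v))) := by
  rw [cutoffProfile_eq_indicator]
  exact continuous_weilConv_weilReflect_cutoff (continuous_profileC _ v) _

/-- … and compactly supported. [folklore] -/
theorem hasCompactSupport_autocorr_cutoffProfile (win : Window) (v : Fin (win.N + 1) → ℝ) :
    HasCompactSupport (weilConv (cutoffProfile win v) (weilReflect (cutoffProfile win v))) := by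
  rw [cutoffProfile_eq_indicator]
  exact hasCompactSupport_weilConv_weilReflect_cutoff _ _

/-- … and vanishes for `|x| > 2a`. [folklore] -/
theorem autocorr_cutoffProfile_eq_zero (win : Window) (v : Fin (win.N + 1) → ℝ) {x : ℝ}
    (hx : 2 * win.a < |x|) :
    weilConv (cutoffProfile win v) (weilReflect (cutoffProfile win v)) x = 0 := by
  rw [cutoffProfile_eq_indicator]
  exact weilConv_weilReflect_cutoff_eq_zero _ hx

/-- `A(0) = ‖G‖₂²`. [folklore] -/
theorem autocorr_cutoffProfile_zero (win : Window) (v : Fin (win.N + 1) → ℝ) :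
    weilConv (cutoffProfile win v) (weilReflect (cutoffProfile win v)) 0 =
      ((∫ t, ‖cutoffProfile win v t‖ ^ 2 : ℝ) : ℂ) :=
  weilConv_weilReflect_apply_zero _

/-! ## §3 Engine corollary: the Weil functional of `A = G ⋆ G̃` is the limit along mollifiers -/

/-- **`W(A ⋆ φ_k) → W(A) = Q(G)`** for the autocorrelation `A` of the cut-off Galerkin profile `G`,
along the tree's mollifiers `φ_k = WeilContinuous.moll k`
(`WeilContinuous.tendsto_weilFunctional_moll` with the continuity / compact support of §2 and
the archimedean integrability of STEP 3b). [folklore] -/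
theorem tendsto_weilFunctional_autocorr_cutoffProfile_moll (win : Window) (v : Fin (win.N + 1) → ℝ) :
    Tendsto (fun k ↦ weilFunctional (weilConv
        (weilConv (cutoffProfile win v) (weilReflect (cutoffProfile win v))) (WeilContinuous.moll k)))
      atTop (𝓝 (weilQuadratic (cutoffProfile win v))) :=
  WeilContinuous.tendsto_weilFunctional_moll (continuous_autocorr_cutoffProfile win v)
    (hasCompactSupport_autocorr_cutoffProfile win v) (integrable_weilArchIntegrand_cutoffProfile win v)

/-- The mollified autocorrelations `A ⋆ φ_k` are Weil test functions. [folklore] -/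
theorem isWeilTest_autocorr_cutoffProfile_moll (win : Window) (v : Fin (win.N + 1) → ℝ) (k : ℕ) :
    IsWeilTest (weilConv (weilConv (cutoffProfile win v) (weilReflect (cutoffProfile win v)))
      (WeilContinuous.moll k)) :=
  WeilContinuous.isWeilTest_weilConv_moll (continuous_autocorr_cutoffProfile win v)
    (hasCompactSupport_autocorr_cutoffProfile win v) k

end Summit.RiemannHypothesis.RiemannHypothesis.Theorems.PfPersistence
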